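import Mathlib.Analysis.Convex.PathConnected
import Mathlib.Analysis.Complex.Basic
import Mathlib.Topology.UnitInterval
import Mathlib.Topology.Order.IntermediateValue
import HarnessLib

/-!
# Trimming a chain of short segments to a tight crossing of an annulus

Topic: Topology / PlaneTopology (companion to `AnnulusArcs.lean`, whose three-arcs lemma
`not_three_arcs_touch` consumes *tight* crossings: paths in a closed annulus `q₁ ≤ |z - x| ≤ q₂`
meeting the inner circle only at their start and the outer circle only at their end). Given a
finite chain of consecutive straight segments `[pts p, pts (p+1)]`, `ps ≤ p ≤ pe`, in the plane,
each of diameter `< q₂ - q₁`, starting strictly inside the circle of radius `q₁` about `x` and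
ending strictly outside the circle of radius `q₂`, we extract such a tight crossing made of a
final piece of one segment, a run of whole segments, and an initial piece of a later segment
(`exists_tight_polyline`): the first segment index `p₂` carrying a point of modulus `≥ q₂`, the
last index `p₁ ≤ p₂` carrying a point of modulus `≤ q₁`, the last point `E` of modulus `q₁` on
segment `p₁` and the first point `F` of modulus `q₂` on segment `p₂`. Everything between is
recorded at the level of segment INDICES (which whole segments lie on the crossing, which carry
no point inside the inner circle / outside the outer one), so that consumers can argue
combinatorially; the only real analysis is the last/first time a continuous function on `[0,1]`
takes a value (`exists_last_eq_of_le`, `exists_first_eq_of_le`). Used for the perturbed medial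
polygon of an FK/percolation interface (Aizenman–Burchard 1999, App. A, "the `k` crossing
segments"). All folklore.
-/

noncomputable section

open Set Metric unitInterval

namespace Literature.Topology.PlaneTopology

/-! ### Last and first times at a level -/

/-- **The last time a continuous function on `[0,1]` is `≤ c`**, when it ends above `c`: there is
`t ≥ s` with `f t = c` and `f > c` after `t` (given `f s ≤ c < f 1`). [folklore] -/
theorem exists_last_eq_of_le {f : I → ℝ} (hf : Continuous f) {s : I} {c : ℝ} (hs : f s ≤ c) (h1 : c < f 1) :
    ∃ t : I, s ≤ t ∧ f t = c ∧ ∀ u : I, t < u → c < f u := by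
  set S : Set I := {u | s ≤ u ∧ f u ≤ c} with hS
  have hSc : IsClosed S := (isClosed_le continuous_const continuous_id).inter (isClosed_le hf continuous_const)
  obtain ⟨t, ⟨hst, hft⟩, hmax⟩ := hSc.isCompact.exists_isGreatest ⟨s, le_rfl, hs⟩
  have hafter : ∀ u : I, t < u → c < f u := by
    intro u htu
    by_contra h
    exact absurd (hmax ⟨hst.trans htu.le, not_lt.1 h⟩) (not_le.2 htu)
  have ht1 : t < 1 := by
    rcases eq_or_lt_of_le (le_one' (t := t)) with h | h
    · rw [h] at hft; linarith
    · exact h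
  refine ⟨t, hst, le_antisymm hft ?_, hafter⟩
  by_contra h
  push Not at h
  have hopen : {u : I | f u < c} ∈ nhds t := (isOpen_lt hf continuous_const).mem_nhds h
  obtain ⟨l', ⟨htl', -⟩, hsub⟩ := exists_Ico_subset_of_mem_nhds' hopen ht1
  obtain ⟨u, htu, hul'⟩ := exists_between htl'
  have h1 : f u < c := hsub ⟨htu.le, hul'⟩
  have h2 := hafter u htu
  linarith

/-- **The first time a continuous function on `[0,1]` is `≥ c`**, when it starts below `c`: there
is `t ≤ s` with `f t = c` and `f < c` before `t` (given `f 0 < c ≤ f s`). [folklore] -/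
theorem exists_first_eq_of_le {f : I → ℝ} (hf : Continuous f) {s : I} {c : ℝ} (hs : c ≤ f s) (h0 : f 0 < c) :
    ∃ t : I, t ≤ s ∧ f t = c ∧ ∀ u : I, u < t → f u < c := by
  set S : Set I := {u | u ≤ s ∧ c ≤ f u} with hS
  have hSc : IsClosed S := (isClosed_le continuous_id continuous_const).inter (isClosed_le continuous_const hf)
  obtain ⟨t, ⟨hts, hft⟩, hmin⟩ := hSc.isCompact.exists_isLeast ⟨s, le_rfl, hs⟩
  have hbefore : ∀ u : I, u < t → f u < c := by
    intro u hut
    by_contra h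
    exact absurd (hmin ⟨hut.le.trans hts, not_lt.1 h⟩) (not_le.2 hut)
  have ht0 : 0 < t := by
    rcases eq_or_lt_of_le (nonneg' (t := t)) with h | h
    · rw [← h] at hft; linarith
    · exact h
  refine ⟨t, hts, le_antisymm ?_ hft, hbefore⟩
  by_contra h
  push Not at h
  have hopen : {u : I | c < f u} ∈ nhds t := (isOpen_lt continuous_const hf).mem_nhds h
  obtain ⟨l', ⟨-, hl't⟩, hsub⟩ := exists_Ioc_subset_of_mem_nhds' hopen ht0
  obtain ⟨u, hl'u, hut⟩ := exists_between hl't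
  have h1 : c < f u := hsub ⟨hl'u, hut.le⟩
  have h2 := hbefore u hut
  linarith

/-! ### Segments: last and first points at a given distance -/

/-- **The last point of a segment at distance `c` from `x`**, when the segment has a point at
distance `≤ c` and ends at distance `> c`: a point `E` of the segment with `dist E x = c` such
that the sub-segment `[E, B]` is at distance `> c` from `x` except at `E`. [folklore] -/
theorem exists_last_of_segment {A B x z : ℂ} {c : ℝ} (hz : z ∈ segment ℝ A B) (hzc : dist z x ≤ c)
    (hB : c < dist B x) :
    ∃ E ∈ segment ℝ A B, dist E x = c ∧ segment ℝ E B ⊆ segment ℝ A B ∧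
      ∀ w ∈ segment ℝ E B, w ≠ E → c < dist w x := by
  set f : I → ℝ := fun u ↦ dist (Path.segment A B u) x with hf
  have hfc : Continuous f := (Path.segment A B).continuous.dist continuous_const
  -- the parameter of `z`
  obtain ⟨s, hs⟩ : ∃ s : I, Path.segment A B s = z := by
    have : z ∈ range (Path.segment A B) := by rw [Path.range_segment]; exact hz
    exact this
  obtain ⟨t, -, hft, hafter⟩ := exists_last_eq_of_le hfc (s := s) (c := c)
    (by change dist (Path.segment A B s) x ≤ c; rw [hs]; exact hzc)
    (by change c < dist (Path.segment A B 1) x; rw [Path.target]; exact hB)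
  set E := Path.segment A B t with hE
  have hEmem : E ∈ segment ℝ A B := by rw [← Path.range_segment]; exact ⟨t, rfl⟩
  have hsub : segment ℝ E B ⊆ segment ℝ A B :=
    (convex_segment A B).segment_subset hEmem (right_mem_segment _ _ _)
  refine ⟨E, hEmem, hft, hsub, fun w hw hwE ↦ ?_⟩
  -- `w = lineMap E B θ` with `θ ∈ (0, 1]`; the corresponding parameter of `[A, B]` is `> t`
  rw [segment_eq_image_lineMap] at hw
  obtain ⟨θ, ⟨hθ0, hθ1⟩, rfl⟩ := hw
  have hθpos : 0 < θ := by
    rcases eq_or_lt_of_le hθ0 with h | h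
    · exfalso; apply hwE; rw [← h]; simp
    · exact h
  -- the parameter `u = t + θ (1 - t)`
  have ht1 : (t : ℝ) ≤ 1 := t.2.2
  have ht0 : (0 : ℝ) ≤ t := t.2.1
  set uval : ℝ := t + θ * (1 - t) with huval
  have hu0 : 0 ≤ uval := by rw [huval]; nlinarith
  have hu1 : uval ≤ 1 := by rw [huval]; nlinarith
  set u : I := ⟨uval, hu0, hu1⟩ with hu
  have hEq : AffineMap.lineMap E B θ = Path.segment A B u := by
    rw [Path.segment_apply, hE, Path.segment_apply]
    change AffineMap.lineMap (AffineMap.lineMap A B (t : ℝ)) B θ = AffineMap.lineMap A B uval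
    simp only [AffineMap.lineMap_apply_module]
    rw [huval]
    module
  rw [hEq]
  rcases eq_or_lt_of_le ht1 with h1 | h1
  · -- `t = 1`: then `E = B` and `w = B`, excluded by `dist E x = c < dist B x`
    exfalso
    have hEB : E = B := by
      rw [hE, Path.segment_apply]
      change AffineMap.lineMap A B (t : ℝ) = B
      rw [h1, AffineMap.lineMap_apply_one]
    have hc : dist B x = c := by rw [← hEB]; exact hft
    linarith
  · have htu : t < u := by
      change (t : ℝ) < uval
      rw [huval]; nlinarith
    exact hafter u htu

/-- **The first point of a segment at distance `c` from `x`**, when the segment starts at distance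
`< c` and has a point at distance `≥ c`: a point `F` with `dist F x = c` such that `[A, F]` is at
distance `< c` from `x` except at `F`. [folklore] -/
theorem exists_first_of_segment {A B x z : ℂ} {c : ℝ} (hz : z ∈ segment ℝ A B) (hzc : c ≤ dist z x)
    (hA : dist A x < c) :
    ∃ F ∈ segment ℝ A B, dist F x = c ∧ segment ℝ A F ⊆ segment ℝ A B ∧
      ∀ w ∈ segment ℝ A F, w ≠ F → dist w x < c := by
  -- apply the previous statement to the reversed segment `[B, A]` and `-dist`? Simpler: rerun
  set f : I → ℝ := fun u ↦ dist (Path.segment A B u) x with hf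
  have hfc : Continuous f := (Path.segment A B).continuous.dist continuous_const
  obtain ⟨s, hs⟩ : ∃ s : I, Path.segment A B s = z := by
    have : z ∈ range (Path.segment A B) := by rw [Path.range_segment]; exact hz
    exact this
  obtain ⟨t, -, hft, hbefore⟩ := exists_first_eq_of_le hfc (s := s) (c := c)
    (by change c ≤ dist (Path.segment A B s) x; rw [hs]; exact hzc)
    (by change dist (Path.segment A B 0) x < c; rw [Path.source]; exact hA)
  set F := Path.segment A B t with hF
  have hFmem : F ∈ segment ℝ A B := by rw [← Path.range_segment]; exact ⟨t, rfl⟩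
  have hsub : segment ℝ A F ⊆ segment ℝ A B :=
    (convex_segment A B).segment_subset (left_mem_segment _ _ _) hFmem
  refine ⟨F, hFmem, hft, hsub, fun w hw hwF ↦ ?_⟩
  rw [segment_eq_image_lineMap] at hw
  obtain ⟨θ, ⟨hθ0, hθ1⟩, rfl⟩ := hw
  have hθlt : θ < 1 := by
    rcases eq_or_lt_of_le hθ1 with h | h
    · exfalso; apply hwF; rw [h]; simp
    · exact h
  have ht0 : (0 : ℝ) ≤ t := t.2.1
  have ht1 : (t : ℝ) ≤ 1 := t.2.2
  set uval : ℝ := θ * t with huval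
  have hu0 : 0 ≤ uval := by rw [huval]; nlinarith
  have hu1 : uval ≤ 1 := by rw [huval]; nlinarith
  set u : I := ⟨uval, hu0, hu1⟩ with hu
  have hEq : AffineMap.lineMap A F θ = Path.segment A B u := by
    rw [Path.segment_apply, hF, Path.segment_apply]
    change AffineMap.lineMap A (AffineMap.lineMap A B (t : ℝ)) θ = AffineMap.lineMap A B uval
    simp only [AffineMap.lineMap_apply_module]
    rw [huval]
    module
  rw [hEq]
  rcases eq_or_lt_of_le ht0 with h0 | h0
  · exfalso
    have hFA : F = A := by
      rw [hF, Path.segment_apply]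
      change AffineMap.lineMap A B (t : ℝ) = A
      rw [← h0, AffineMap.lineMap_apply_zero]
    have hc : dist A x = c := by rw [← hFA]; exact hft
    linarith
  · have hut : u < t := by
      change uval < (t : ℝ)
      rw [huval]; nlinarith
    exact hbefore u hut

/-! ### Chains of segments as paths -/

/-- The path along the whole segments `[pts p, pts (p+1)], …, [pts (p+d-1), pts (p+d)]`
(constant path for `d = 0`). [folklore] -/
def chainPath (pts : ℕ → ℂ) (p : ℕ) : ∀ d : ℕ, Path (pts p) (pts (p + d))
  | 0 => Path.refl (pts p)
  | d + 1 => (chainPath pts p d).trans (Path.segment (pts (p + d)) (pts (p + d + 1)))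

/-- The range of the chain path is its start point together with its segments. [folklore] -/
theorem range_chainPath (pts : ℕ → ℂ) (p : ℕ) : ∀ d : ℕ,
    range (chainPath pts p d) = {pts p} ∪ ⋃ i ∈ Finset.range d, segment ℝ (pts (p + i)) (pts (p + i + 1))
  | 0 => by
    simp only [chainPath, Finset.range_zero, Finset.notMem_empty, iUnion_of_empty, iUnion_empty, union_empty]
    ext z; simp [Path.refl, eq_comm]
  | d + 1 => by
    rw [chainPath, Path.trans_range, range_chainPath pts p d, Path.range_segment, Finset.range_add_one]
    ext z
    simp only [mem_union, mem_singleton_iff, mem_iUnion, Finset.mem_insert, exists_prop]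
    constructor
    · rintro ((h | ⟨i, hi, hz⟩) | hz)
      · exact Or.inl h
      · exact Or.inr ⟨i, Or.inr hi, hz⟩
      · exact Or.inr ⟨d, Or.inl rfl, hz⟩
    · rintro (h | ⟨i, rfl | hi, hz⟩)
      · exact Or.inl (Or.inl h)
      · exact Or.inr hz
      · exact Or.inl (Or.inr ⟨i, hi, hz⟩)

/-! ### The tight crossing extracted from a chain of short segments -/

/-- **A chain of short segments from inside a circle to outside a larger one contains a tight
crossing of the annulus.** Let `[pts p, pts (p+1)]`, `ps ≤ p ≤ pe`, be segments of diameter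
`< q₂ - q₁` with `dist (pts ps) x < q₁` and `q₂ < dist (pts (pe+1)) x`. Then there are indices
`ps ≤ p₁ < p₂ ≤ pe`, points `E` on segment `p₁` and `F` on segment `p₂` with `dist E x = q₁`,
`dist F x = q₂`, and a path `T` from `E` to `F` whose range is `[E, pts (p₁+1)]`, the whole
segments strictly between, and `[pts p₂, F]`, lying in the closed annulus `q₁ ≤ dist · x ≤ q₂`
and meeting the circle of radius `q₁` only at `E` and the circle of radius `q₂` only at `F`.
Moreover the segments `ps ≤ p < p₂` carry no point at distance `≥ q₂` and the segments
`p₁ < p ≤ p₂` no point at distance `≤ q₁` (so the segment of any point of `T` far from both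
circles, and its neighbours, are whole inner segments of `T`). [folklore] -/
theorem exists_tight_polyline (pts : ℕ → ℂ) (x : ℂ) {q₁ q₂ : ℝ} {ps pe : ℕ} (hpse : ps ≤ pe)
    (hdiam : ∀ p, ps ≤ p → p ≤ pe → ∀ z ∈ segment ℝ (pts p) (pts (p + 1)),
      ∀ w ∈ segment ℝ (pts p) (pts (p + 1)), dist z w < q₂ - q₁)
    (hstart : dist (pts ps) x < q₁) (hend : q₂ < dist (pts (pe + 1)) x) :
    ∃ (p₁ p₂ : ℕ) (E F : ℂ) (T : Path E F), ps ≤ p₁ ∧ p₁ < p₂ ∧ p₂ ≤ pe ∧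
      E ∈ segment ℝ (pts p₁) (pts (p₁ + 1)) ∧ F ∈ segment ℝ (pts p₂) (pts (p₂ + 1)) ∧
      dist E x = q₁ ∧ dist F x = q₂ ∧
      range T = segment ℝ E (pts (p₁ + 1)) ∪
        (⋃ p ∈ Finset.Ioo p₁ p₂, segment ℝ (pts p) (pts (p + 1))) ∪ segment ℝ (pts p₂) F ∧
      range T ⊆ (⋃ p ∈ Finset.Icc p₁ p₂, segment ℝ (pts p) (pts (p + 1))) ∧
      (∀ z ∈ range T, q₁ ≤ dist z x ∧ dist z x ≤ q₂ ∧ (dist z x = q₁ → z = E) ∧ (dist z x = q₂ → z = F)) ∧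
      (∀ p, ps ≤ p → p < p₂ → ∀ z ∈ segment ℝ (pts p) (pts (p + 1)), dist z x < q₂) ∧
      (∀ p, p₁ < p → p ≤ p₂ → ∀ z ∈ segment ℝ (pts p) (pts (p + 1)), q₁ < dist z x) := by
  classical
  -- `p₂`: the first segment with a point at distance `≥ q₂`
  have hex₂ : ∃ p, ps ≤ p ∧ p ≤ pe ∧ ∃ z ∈ segment ℝ (pts p) (pts (p + 1)), q₂ ≤ dist z x :=
    ⟨pe, hpse, le_rfl, pts (pe + 1), right_mem_segment _ _ _, hend.le⟩
  set p₂ := Nat.find hex₂ with hp₂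
  obtain ⟨hps₂, hp₂e, z₂, hz₂, hz₂d⟩ := Nat.find_spec hex₂
  have hmin₂ : ∀ p, ps ≤ p → p < p₂ → ∀ z ∈ segment ℝ (pts p) (pts (p + 1)), dist z x < q₂ := by
    intro p hps hpp₂ z hz
    by_contra h
    exact Nat.find_min hex₂ hpp₂ ⟨hps, hpp₂.le.trans hp₂e, z, hz, not_lt.1 h⟩
  -- `ps < p₂`: the first segment has a point inside the small circle, hence none beyond the big one
  have hps₂' : ps < p₂ := by
    refine lt_of_le_of_ne hps₂ fun h ↦ ?_
    have h1 := hdiam ps le_rfl hpse (pts ps) (left_mem_segment _ _ _) z₂ (h ▸ hz₂)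
    linarith [dist_triangle z₂ (pts ps) x, dist_comm z₂ (pts ps)]
  -- `p₁`: the last segment `≤ p₂` with a point at distance `≤ q₁`
  set P₁ : ℕ → Prop := fun p ↦ ∃ z ∈ segment ℝ (pts p) (pts (p + 1)), dist z x ≤ q₁ with hP₁
  set p₁ := Nat.findGreatest P₁ p₂ with hp₁
  have hPps : P₁ ps := ⟨pts ps, left_mem_segment _ _ _, hstart.le⟩
  have hps₁ : ps ≤ p₁ := Nat.le_findGreatest hps₂ hPps
  have hp₁₂ : p₁ ≤ p₂ := Nat.findGreatest_le _
  have hP₁p₁ : P₁ p₁ := Nat.findGreatest_spec hps₂ hPps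
  obtain ⟨z₁, hz₁, hz₁d⟩ := hP₁p₁
  have hmax₁ : ∀ p, p₁ < p → p ≤ p₂ → ∀ z ∈ segment ℝ (pts p) (pts (p + 1)), q₁ < dist z x := by
    intro p hp₁p hpp₂ z hz
    by_contra h
    exact Nat.findGreatest_is_greatest hp₁p hpp₂ ⟨z, hz, not_lt.1 h⟩
  -- `p₁ < p₂`: a segment cannot meet both circles
  have hp₁₂' : p₁ < p₂ := by
    refine lt_of_le_of_ne hp₁₂ fun h ↦ ?_
    have h1 := hdiam p₁ hps₁ (hp₁₂.trans hp₂e) z₁ hz₁ z₂ (h ▸ hz₂)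
    linarith [dist_triangle z₂ z₁ x, dist_comm z₂ z₁]
  have hp₁e : p₁ ≤ pe := hp₁₂.trans hp₂e
  -- the point `E` on segment `p₁`: its end has distance `> q₁` (it lies on segment `p₁ + 1`)
  have hB : q₁ < dist (pts (p₁ + 1)) x :=
    hmax₁ (p₁ + 1) (Nat.lt_succ_self _) hp₁₂' _ (left_mem_segment _ _ _)
  obtain ⟨E, hEmem, hEd, hEsub, hEafter⟩ := exists_last_of_segment hz₁ hz₁d hB
  -- the point `F` on segment `p₂`: its start has distance `< q₂` (it lies on segment `p₂ - 1`)
  have hA : dist (pts p₂) x < q₂ := by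
    have h := hmin₂ (p₂ - 1) (by omega) (by omega) (pts (p₂ - 1 + 1)) (right_mem_segment _ _ _)
    rwa [Nat.sub_add_cancel (by omega : 1 ≤ p₂)] at h
  obtain ⟨F, hFmem, hFd, hFsub, hFbefore⟩ := exists_first_of_segment hz₂ hz₂d hA
  -- the path: `[E, pts (p₁+1)]`, whole segments `p₁ < p < p₂`, `[pts p₂, F]`
  set d := p₂ - (p₁ + 1) with hd
  have hpd : p₁ + 1 + d = p₂ := by omega
  set Tmid : Path (pts (p₁ + 1)) (pts p₂) := (chainPath pts (p₁ + 1) d).cast rfl (by rw [hpd]) with hTmid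
  set T : Path E F := (Path.segment E (pts (p₁ + 1))).trans (Tmid.trans (Path.segment (pts p₂) F)) with hT
  have hTmid_range : range Tmid = {pts (p₁ + 1)} ∪ ⋃ i ∈ Finset.range d, segment ℝ (pts (p₁ + 1 + i)) (pts (p₁ + 1 + i + 1)) := by
    rw [hTmid, Path.cast_coe, range_chainPath]
  have hrangeT : range T = segment ℝ E (pts (p₁ + 1)) ∪
      (⋃ p ∈ Finset.Ioo p₁ p₂, segment ℝ (pts p) (pts (p + 1))) ∪ segment ℝ (pts p₂) F := by
    rw [hT, Path.trans_range, Path.trans_range, Path.range_segment, Path.range_segment, hTmid_range]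
    ext z
    simp only [mem_union, mem_singleton_iff, mem_iUnion, Finset.mem_range, Finset.mem_Ioo, exists_prop]
    constructor
    · rintro (hz | (rfl | ⟨i, hi, hz⟩) | hz)
      · exact Or.inl (Or.inl hz)
      · exact Or.inl (Or.inl (right_mem_segment _ _ _))
      · exact Or.inl (Or.inr ⟨p₁ + 1 + i, ⟨by omega, by omega⟩, hz⟩)
      · exact Or.inr hz
    · rintro ((hz | ⟨p, ⟨hp1, hp2⟩, hz⟩) | hz)
      · exact Or.inl hz
      · refine Or.inr (Or.inl (Or.inr ⟨p - (p₁ + 1), by omega, ?_⟩))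
        rwa [show p₁ + 1 + (p - (p₁ + 1)) = p by omega]
      · exact Or.inr (Or.inr hz)
  refine ⟨p₁, p₂, E, F, T, hps₁, hp₁₂', hp₂e, hEmem, hFmem, hEd, hFd, hrangeT, ?_, ?_, hmin₂, hmax₁⟩
  · -- range in the segments `p₁ ≤ p ≤ p₂`
    rw [hrangeT]
    rintro z ((hz | hz) | hz)
    · exact mem_iUnion₂.2 ⟨p₁, Finset.mem_Icc.2 ⟨le_rfl, hp₁₂⟩, hEsub hz⟩
    · obtain ⟨p, hp, hz⟩ := mem_iUnion₂.1 hz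
      rw [Finset.mem_Ioo] at hp
      exact mem_iUnion₂.2 ⟨p, Finset.mem_Icc.2 ⟨hp.1.le, hp.2.le⟩, hz⟩
    · exact mem_iUnion₂.2 ⟨p₂, Finset.mem_Icc.2 ⟨hp₁₂, le_rfl⟩, hFsub hz⟩
  · -- distances on the range
    rw [hrangeT]
    rintro z ((hz | hz) | hz)
    · -- on `[E, pts (p₁+1)] ⊆ segment p₁`: `≥ q₁`, `= q₁` only at `E`; `< q₂` since `p₁ < p₂`
      have hlt : dist z x < q₂ := hmin₂ p₁ hps₁ hp₁₂' z (hEsub hz)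
      by_cases hzE : z = E
      · subst hzE
        exact ⟨hEd.ge, hlt.le, fun _ ↦ rfl, fun h ↦ absurd h hlt.ne⟩
      · have hgt := hEafter z hz hzE
        exact ⟨hgt.le, hlt.le, fun h ↦ absurd h hgt.ne', fun h ↦ absurd h hlt.ne⟩
    · obtain ⟨p, hp, hz⟩ := mem_iUnion₂.1 hz
      rw [Finset.mem_Ioo] at hp
      have hgt := hmax₁ p hp.1 hp.2.le z hz
      have hlt := hmin₂ p (by omega) hp.2 z hz
      exact ⟨hgt.le, hlt.le, fun h ↦ absurd h hgt.ne', fun h ↦ absurd h hlt.ne⟩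
    · have hgt : q₁ < dist z x := hmax₁ p₂ hp₁₂' le_rfl z (hFsub hz)
      by_cases hzF : z = F
      · subst hzF
        exact ⟨hgt.le, hFd.le, fun h ↦ absurd h hgt.ne', fun _ ↦ rfl⟩
      · have hlt := hFbefore z hz hzF
        exact ⟨hgt.le, hlt.le, fun h ↦ absurd h hgt.ne', fun h ↦ absurd h hlt.ne⟩


/-- **Mirror statement: a chain of short segments from outside the larger circle to inside the
smaller one contains a tight crossing**, obtained from `exists_tight_polyline` applied to the
reversed chain. Now `p₂ < p₁`: `F` (distance `q₂`) lies on the earlier segment `p₂`, `E`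
(distance `q₁`) on the later segment `p₁`; the path runs from `E` back to `F` through
`[E, pts p₁]`, the whole segments strictly between (indices decreasing) and `[pts (p₂+1), F]`.
[folklore] -/
theorem exists_tight_polyline' (pts : ℕ → ℂ) (x : ℂ) {q₁ q₂ : ℝ} {ps pe : ℕ} (hpse : ps ≤ pe)
    (hdiam : ∀ p, ps ≤ p → p ≤ pe → ∀ z ∈ segment ℝ (pts p) (pts (p + 1)),
      ∀ w ∈ segment ℝ (pts p) (pts (p + 1)), dist z w < q₂ - q₁)
    (hstart : q₂ < dist (pts ps) x) (hend : dist (pts (pe + 1)) x < q₁) :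
    ∃ (p₁ p₂ : ℕ) (E F : ℂ) (T : Path E F), ps ≤ p₂ ∧ p₂ < p₁ ∧ p₁ ≤ pe ∧
      E ∈ segment ℝ (pts p₁) (pts (p₁ + 1)) ∧ F ∈ segment ℝ (pts p₂) (pts (p₂ + 1)) ∧
      dist E x = q₁ ∧ dist F x = q₂ ∧
      range T = segment ℝ E (pts p₁) ∪
        (⋃ p ∈ Finset.Ioo p₂ p₁, segment ℝ (pts p) (pts (p + 1))) ∪ segment ℝ (pts (p₂ + 1)) F ∧
      range T ⊆ (⋃ p ∈ Finset.Icc p₂ p₁, segment ℝ (pts p) (pts (p + 1))) ∧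
      (∀ z ∈ range T, q₁ ≤ dist z x ∧ dist z x ≤ q₂ ∧ (dist z x = q₁ → z = E) ∧ (dist z x = q₂ → z = F)) ∧
      (∀ p, p₂ < p → p ≤ pe → ∀ z ∈ segment ℝ (pts p) (pts (p + 1)), dist z x < q₂) ∧
      (∀ p, p₂ ≤ p → p < p₁ → ∀ z ∈ segment ℝ (pts p) (pts (p + 1)), q₁ < dist z x) := by
  -- the reversed chain `pts' k = pts (N - k)`, `N = ps + pe + 1`; its segment `k` is segment `N - k - 1`
  set N := ps + pe + 1 with hN
  set pts' : ℕ → ℂ := fun k ↦ pts (N - k) with hpts'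
  have hseg : ∀ k, k ≤ pe → segment ℝ (pts' k) (pts' (k + 1)) = segment ℝ (pts (N - k - 1)) (pts (N - k - 1 + 1)) := by
    intro k hk
    simp only [hpts']
    rw [segment_symm, show N - (k + 1) = N - k - 1 by omega, show N - k - 1 + 1 = N - k by omega]
  obtain ⟨k₁, k₂, E, F, T, hk₁, hk₁₂, hk₂, hE, hF, hEd, hFd, hrange, hsub, htight, hlt₂, hgt₁⟩ :=
    exists_tight_polyline pts' x hpse (fun k hk1 hk2 z hz w hw ↦ by
        rw [hseg k hk2] at hz hw
        exact hdiam (N - k - 1) (by omega) (by omega) z hz w hw)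
      (by simp only [hpts']; rwa [show N - ps = pe + 1 by omega])
      (by simp only [hpts']; rwa [show N - (pe + 1) = ps by omega])
  refine ⟨N - k₁ - 1, N - k₂ - 1, E, F, T, by omega, by omega, by omega, ?_, ?_, hEd, hFd, ?_, ?_, htight, ?_, ?_⟩
  · rwa [hseg k₁ (by omega)] at hE
  · rwa [hseg k₂ hk₂] at hF
  · rw [hrange]
    have h1 : pts' (k₁ + 1) = pts (N - k₁ - 1) := by simp only [hpts']; rw [show N - (k₁ + 1) = N - k₁ - 1 by omega]
    have h2 : pts' k₂ = pts (N - k₂ - 1 + 1) := by simp only [hpts']; rw [show N - k₂ - 1 + 1 = N - k₂ by omega]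
    rw [h1, h2]
    congr 2
    ext z
    simp only [mem_iUnion, Finset.mem_Ioo, exists_prop]
    constructor
    · rintro ⟨k, ⟨hk1, hk2⟩, hz⟩
      rw [hseg k (by omega)] at hz
      exact ⟨N - k - 1, ⟨by omega, by omega⟩, hz⟩
    · rintro ⟨p, ⟨hp1, hp2⟩, hz⟩
      refine ⟨N - p - 1, ⟨by omega, by omega⟩, ?_⟩
      rw [hseg (N - p - 1) (by omega), show N - (N - p - 1) - 1 = p by omega]
      exact hz
  · refine hsub.trans ?_
    intro z hz
    obtain ⟨k, hk, hz⟩ := mem_iUnion₂.1 hz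
    rw [Finset.mem_Icc] at hk
    rw [hseg k (by omega)] at hz
    exact mem_iUnion₂.2 ⟨N - k - 1, Finset.mem_Icc.2 ⟨by omega, by omega⟩, hz⟩
  · intro p hp1 hp2 z hz
    have h := hlt₂ (N - p - 1) (by omega) (by omega) z
    rw [hseg (N - p - 1) (by omega), show N - (N - p - 1) - 1 = p by omega] at h
    exact h hz
  · intro p hp1 hp2 z hz
    have h := hgt₁ (N - p - 1) (by omega) (by omega) z
    rw [hseg (N - p - 1) (by omega), show N - (N - p - 1) - 1 = p by omega] at h
    exact h hz

end Literature.Topology.PlaneTopology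

end
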